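import Summits.CriticalPhenomena.PercolationContinuityZ3.Theorems.PercNearOneGluingNoHeavyConstsClusterSquareNDCPos
import HarnessLib

/-!
# No double clash: symmetry in `b, c` and contraction of pendant terminals

builds on p205010 (kernel theorem, internal audit signed; external expert review pending)

PAPER-2 track "percolation constants", part (ii), seat `prim-consts-1`, gen 17 (lane index
`run/shared/lean/prim/consts/CONSTANTS.md`, row A19; memo `FROM-prim-consts-1-g17-THREE-COPY-STRUCTURE.md` §2b).
Support file for the crux `NoHeavyLowerTail` (stmt-CriticalPhenomena-4575; `--supports`).  Theorems only; no sorries.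

Two reductions for the no-double-clash hypothesis `NDC(a; b, c)` of `Consts.clusterSquare_le_sq_of_noDoubleClash_pos` (stated for
configurations of positive pairs): it is symmetric in `b, c` (`Consts.noDoubleClash_comm`), and **pendant terminals contract**: if the
only positive pair at `c` is `{c, c₁}`, then `NDC(a; b, c₁) ⟹ NDC(a; b, c)` (`Consts.noDoubleClash_of_pendant_third`;
in a double clash the cluster of `c` in `ω` and in `η'` is non-trivial, so it passes through `c₁`, and the same clash data serve
`(a; b, c₁)`); if the only positive pair at the root `a` is `{a, a₁}`, then `NDC(a₁; b, c) ⟹ NDC(a; b, c)`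
(`Consts.noDoubleClash_of_pendant_root`; a double clash needs two distinct clash vertices adjacent to `K = C_a(ω)`, so `K ≠ {a}`,
`a₁ ∈ K = C_{a₁}(ω)` and the deleted pairs coincide); and if every positive pair at `c` goes to `a` or `b` there is no `c`-clash at all
(`Consts.noDoubleClash_of_pendant_at_terminal`).  Combined with the criteria of `…ClusterSquareThin/Separated/ClusterSeparated`, applied
to the contracted terminals, this settles e.g. the six-vertex graphs in which `c` hangs off a hub that the criteria alone miss
(lane census `eng/crit7_census.py`: 6 443 of 6 519 NDC-true rooted graphs of the six-vertex sample, never unsound).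
Reference: N. Gladkov, arXiv:2408.08457v2 (2024), Thm. 4.3, Def. 4.2, Lemma 3.1, Example 2.5.
-/

noncomputable section

open Classical

namespace Summit.CriticalPhenomena.PercolationContinuityZ3.Theorems

open MeasureTheory Finset Literature.Probability.LatticeModels Literature.Probability.Percolation
open Literature.Probability.Percolation.DecisionTree Literature.Probability.Percolation.BHK2006
open Literature.Probability.Percolation.TargetExploration Literature.Probability.Percolation.ClusterConditioning

namespace Consts

variable {V : Type*}

/-- If every open pair at `c` goes to `c₁`, an open connection from `c` to a vertex `z ≠ c` passes through `c₁`. [folklore] -/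
theorem reachable_pendant {ξ : Set (Sym2 V)} {c c₁ z : V} (hpend : ∀ x, (openGraph ξ).Adj c x → x = c₁)
    (hz : (openGraph ξ).Reachable c z) (hzc : z ≠ c) : (openGraph ξ).Reachable c c₁ ∧ (openGraph ξ).Reachable c₁ z := by
  obtain ⟨W⟩ := hz
  cases W with
  | nil => exact absurd rfl hzc
  | @cons _ x _ h W' =>
    obtain rfl := hpend x h
    exact ⟨h.reachable, ⟨W'⟩⟩

/-- **`NDC(a; b, c)` is symmetric in `b, c`.** [folklore; bookkeeping for Gladkov2024, Thm. 4.3] -/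
theorem noDoubleClash_comm (w : Sym2 V → unitInterval) {a b c : V}
    (h : ∀ ω η : Set (Sym2 V), (∀ e ∈ ω, (0 : ℝ) < w e) → (∀ e ∈ η, (0 : ℝ) < w e) →
      ¬ (openGraph ω).Reachable a b → ¬ (openGraph ω).Reachable a c →
      ¬ (openGraph ω).Reachable b c → ¬ (openGraph (η \ barOf {a} (setCl ω {a}))).Reachable b c →
      ¬ ((∃ y k : V, (openGraph ω).Reachable a k ∧ (0 : ℝ) < w s(k, y) ∧ (openGraph ω).Reachable b y ∧
            (openGraph (η \ barOf {a} (setCl ω {a}))).Reachable c y) ∧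
         (∃ y k : V, (openGraph ω).Reachable a k ∧ (0 : ℝ) < w s(k, y) ∧ (openGraph ω).Reachable c y ∧
            (openGraph (η \ barOf {a} (setCl ω {a}))).Reachable b y))) :
    ∀ ω η : Set (Sym2 V), (∀ e ∈ ω, (0 : ℝ) < w e) → (∀ e ∈ η, (0 : ℝ) < w e) →
      ¬ (openGraph ω).Reachable a c → ¬ (openGraph ω).Reachable a b →
      ¬ (openGraph ω).Reachable c b → ¬ (openGraph (η \ barOf {a} (setCl ω {a}))).Reachable c b →
      ¬ ((∃ y k : V, (openGraph ω).Reachable a k ∧ (0 : ℝ) < w s(k, y) ∧ (openGraph ω).Reachable c y ∧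
            (openGraph (η \ barOf {a} (setCl ω {a}))).Reachable b y) ∧
         (∃ y k : V, (openGraph ω).Reachable a k ∧ (0 : ℝ) < w s(k, y) ∧ (openGraph ω).Reachable b y ∧
            (openGraph (η \ barOf {a} (setCl ω {a}))).Reachable c y)) := by
  intro ω η hω hη hac hab hcb hcb' hcl
  exact h ω η hω hη hab hac (fun h' => hcb h'.symm) (fun h' => hcb' h'.symm) ⟨hcl.2, hcl.1⟩

/-- **No `c`-clash when `c` hangs off `a` or `b` only**: if every positive pair at `c` goes to `a` or to `b`, then `NDC(a; b, c)`
holds outright. [folklore; input for Gladkov2024, Thm. 4.3] -/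
theorem noDoubleClash_of_pendant_at_terminal (w : Sym2 V → unitInterval) {a b c : V}
    (hpend : ∀ x, x ≠ c → (0 : ℝ) < w s(c, x) → x = a ∨ x = b) :
    ∀ ω η : Set (Sym2 V), (∀ e ∈ ω, (0 : ℝ) < w e) → (∀ e ∈ η, (0 : ℝ) < w e) →
      ¬ (openGraph ω).Reachable a b → ¬ (openGraph ω).Reachable a c →
      ¬ (openGraph ω).Reachable b c → ¬ (openGraph (η \ barOf {a} (setCl ω {a}))).Reachable b c →
      ¬ ((∃ y k : V, (openGraph ω).Reachable a k ∧ (0 : ℝ) < w s(k, y) ∧ (openGraph ω).Reachable b y ∧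
            (openGraph (η \ barOf {a} (setCl ω {a}))).Reachable c y) ∧
         (∃ y k : V, (openGraph ω).Reachable a k ∧ (0 : ℝ) < w s(k, y) ∧ (openGraph ω).Reachable c y ∧
            (openGraph (η \ barOf {a} (setCl ω {a}))).Reachable b y)) := by
  rintro ω η hω - - hac hbc hbc' ⟨-, ⟨y', k', -, -, hcy', hby'⟩⟩
  have hy'c : y' ≠ c := by rintro rfl; exact hbc' hby'
  obtain ⟨W⟩ := hcy'
  cases W with
  | nil => exact hy'c rfl
  | @cons _ x _ h W' =>
    have hx := (openGraph_adj ω c x).1 h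
    rcases hpend x (fun hxc => hx.2 hxc.symm) (hω _ hx.1) with rfl | rfl
    · exact hac h.reachable.symm
    · exact hbc h.reachable.symm

/-- **Pendant third terminal contracts**: if the only positive pair at `c` is `{c, c₁}`, then `NDC(a; b, c₁) ⟹ NDC(a; b, c)`
(for `c₁ ∈ {a, b}` see also `Consts.noDoubleClash_of_pendant_at_terminal`). [folklore; input for Gladkov2024, Thm. 4.3] -/
theorem noDoubleClash_of_pendant_third (w : Sym2 V → unitInterval) {a b c c₁ : V}
    (hpend : ∀ x, x ≠ c → (0 : ℝ) < w s(c, x) → x = c₁)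
    (h : ∀ ω η : Set (Sym2 V), (∀ e ∈ ω, (0 : ℝ) < w e) → (∀ e ∈ η, (0 : ℝ) < w e) →
      ¬ (openGraph ω).Reachable a b → ¬ (openGraph ω).Reachable a c₁ →
      ¬ (openGraph ω).Reachable b c₁ → ¬ (openGraph (η \ barOf {a} (setCl ω {a}))).Reachable b c₁ →
      ¬ ((∃ y k : V, (openGraph ω).Reachable a k ∧ (0 : ℝ) < w s(k, y) ∧ (openGraph ω).Reachable b y ∧
            (openGraph (η \ barOf {a} (setCl ω {a}))).Reachable c₁ y) ∧
         (∃ y k : V, (openGraph ω).Reachable a k ∧ (0 : ℝ) < w s(k, y) ∧ (openGraph ω).Reachable c₁ y ∧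
            (openGraph (η \ barOf {a} (setCl ω {a}))).Reachable b y))) :
    ∀ ω η : Set (Sym2 V), (∀ e ∈ ω, (0 : ℝ) < w e) → (∀ e ∈ η, (0 : ℝ) < w e) →
      ¬ (openGraph ω).Reachable a b → ¬ (openGraph ω).Reachable a c →
      ¬ (openGraph ω).Reachable b c → ¬ (openGraph (η \ barOf {a} (setCl ω {a}))).Reachable b c →
      ¬ ((∃ y k : V, (openGraph ω).Reachable a k ∧ (0 : ℝ) < w s(k, y) ∧ (openGraph ω).Reachable b y ∧
            (openGraph (η \ barOf {a} (setCl ω {a}))).Reachable c y) ∧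
         (∃ y k : V, (openGraph ω).Reachable a k ∧ (0 : ℝ) < w s(k, y) ∧ (openGraph ω).Reachable c y ∧
            (openGraph (η \ barOf {a} (setCl ω {a}))).Reachable b y)) := by
  rintro ω η hω hη hab hac hbc hbc' ⟨⟨y, k, hk, hw, hby, hcy⟩, ⟨y', k', hk', hw', hcy', hby'⟩⟩
  set θ := η \ barOf {a} (setCl ω {a}) with hθdef
  have hθpos : ∀ e ∈ θ, (0 : ℝ) < w e := fun e he => hη e he.1
  have hpendξ : ∀ ξ : Set (Sym2 V), (∀ e ∈ ξ, (0 : ℝ) < w e) → ∀ x, (openGraph ξ).Adj c x → x = c₁ := by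
    intro ξ hξ x hx
    have hx' := (openGraph_adj ξ c x).1 hx
    exact hpend x (fun hxc => hx'.2 hxc.symm) (hξ _ hx'.1)
  have hyc : y ≠ c := by rintro rfl; exact hbc hby
  have hy'c : y' ≠ c := by rintro rfl; exact hbc' hby'
  obtain ⟨hcc₁ω, hc₁y'⟩ := reachable_pendant (hpendξ ω hω) hcy' hy'c
  obtain ⟨hcc₁θ, hc₁y⟩ := reachable_pendant (hpendξ θ hθpos) hcy hyc
  exact h ω η hω hη hab (fun h' => hac (h'.trans hcc₁ω.symm)) (fun h' => hbc (h'.trans hcc₁ω.symm))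
    (fun h' => hbc' (h'.trans hcc₁θ.symm)) ⟨⟨y, k, hk, hw, hby, hc₁y⟩, ⟨y', k', hk', hw', hc₁y', hby'⟩⟩

/-- **Pendant root contracts**: if the only positive pair at the root `a` is `{a, a₁}`, then `NDC(a₁; b, c) ⟹ NDC(a; b, c)`. [folklore; input for Gladkov2024, Thm. 4.3] -/
theorem noDoubleClash_of_pendant_root (w : Sym2 V → unitInterval) {a a₁ b c : V}
    (hpend : ∀ x, x ≠ a → (0 : ℝ) < w s(a, x) → x = a₁)
    (h : ∀ ω η : Set (Sym2 V), (∀ e ∈ ω, (0 : ℝ) < w e) → (∀ e ∈ η, (0 : ℝ) < w e) →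
      ¬ (openGraph ω).Reachable a₁ b → ¬ (openGraph ω).Reachable a₁ c →
      ¬ (openGraph ω).Reachable b c → ¬ (openGraph (η \ barOf {a₁} (setCl ω {a₁}))).Reachable b c →
      ¬ ((∃ y k : V, (openGraph ω).Reachable a₁ k ∧ (0 : ℝ) < w s(k, y) ∧ (openGraph ω).Reachable b y ∧
            (openGraph (η \ barOf {a₁} (setCl ω {a₁}))).Reachable c y) ∧
         (∃ y k : V, (openGraph ω).Reachable a₁ k ∧ (0 : ℝ) < w s(k, y) ∧ (openGraph ω).Reachable c y ∧
            (openGraph (η \ barOf {a₁} (setCl ω {a₁}))).Reachable b y))) :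
    ∀ ω η : Set (Sym2 V), (∀ e ∈ ω, (0 : ℝ) < w e) → (∀ e ∈ η, (0 : ℝ) < w e) →
      ¬ (openGraph ω).Reachable a b → ¬ (openGraph ω).Reachable a c →
      ¬ (openGraph ω).Reachable b c → ¬ (openGraph (η \ barOf {a} (setCl ω {a}))).Reachable b c →
      ¬ ((∃ y k : V, (openGraph ω).Reachable a k ∧ (0 : ℝ) < w s(k, y) ∧ (openGraph ω).Reachable b y ∧
            (openGraph (η \ barOf {a} (setCl ω {a}))).Reachable c y) ∧
         (∃ y k : V, (openGraph ω).Reachable a k ∧ (0 : ℝ) < w s(k, y) ∧ (openGraph ω).Reachable c y ∧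
            (openGraph (η \ barOf {a} (setCl ω {a}))).Reachable b y)) := by
  rintro ω η hω hη hab hac hbc hbc' ⟨⟨y, k, hk, hw, hby, hcy⟩, ⟨y', k', hk', hw', hcy', hby'⟩⟩
  have hpendω : ∀ x, (openGraph ω).Adj a x → x = a₁ := by
    intro x hx
    have hx' := (openGraph_adj ω a x).1 hx
    exact hpend x (fun hxa => hx'.2 hxa.symm) (hω _ hx'.1)
  -- `a₁ ∈ K = C_a(ω)`: the two clash vertices are distinct, so one of `k, k'` differs from `a` (else `y = y' = a₁`)
  have hya : y ≠ a := by rintro rfl; exact hab hby.symm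
  have hy'a : y' ≠ a := by rintro rfl; exact hac hcy'.symm
  have haa₁ : (openGraph ω).Reachable a a₁ := by
    by_cases hka : k = a
    · by_cases hk'a : k' = a
      · subst hka; subst hk'a
        have h1 : y = a₁ := hpend y hya hw
        have h2 : y' = a₁ := hpend y' hy'a hw'
        exact absurd (hby.trans (h1.trans h2.symm ▸ hcy'.symm)) hbc
      · exact (reachable_pendant hpendω hk' hk'a).1
    · exact (reachable_pendant hpendω hk hka).1
  have hcut : barOf {a} (setCl ω {a}) = barOf {a₁} (setCl ω {a₁}) := by
    rw [barOf_setCl_singleton_eq_cutSet, barOf_setCl_singleton_eq_cutSet]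
    ext e
    simp only [cutSet, Set.mem_setOf_eq]
    constructor
    · rintro ⟨u, hu, hr⟩; exact ⟨u, hu, haa₁.symm.trans hr⟩
    · rintro ⟨u, hu, hr⟩; exact ⟨u, hu, haa₁.trans hr⟩
  rw [hcut] at hbc' hcy hby'
  exact h ω η hω hη (fun h' => hab (haa₁.trans h')) (fun h' => hac (haa₁.trans h')) hbc hbc'
    ⟨⟨y, k, haa₁.symm.trans hk, hw, hby, hcy⟩, ⟨y', k', haa₁.symm.trans hk', hw', hcy', hby'⟩⟩

/-! ### Near-pendant terminals: positive pairs to the other terminals do not matter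

The pairs `{c, a}`, `{c, b}` (resp. `{a, b}`, `{a, c}`) are closed in `ω` and closed or deleted in `η'`, so the contractions of
`Consts.noDoubleClash_of_pendant_third` / `_root` only need the positive pairs towards NON-terminals to go to a single vertex.  With these
near-pendant contractions the criteria of `…ClusterSquareClusterSeparated` cover 6 480 of the 6 519 NDC-true rooted graphs of the lane's
six-vertex sample (`eng/crit9_census.py`). -/

/-- **Near-pendant third terminal contracts**: if every positive pair at `c` other than `{c, a}`, `{c, b}` goes to `c₁`, then
`NDC(a; b, c₁) ⟹ NDC(a; b, c)` (the pairs `{c, a}`, `{c, b}` are closed in `ω` and deleted or closed in `η'`).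
[folklore; input for Gladkov2024, Thm. 4.3] -/
theorem noDoubleClash_of_nearPendant_third (w : Sym2 V → unitInterval) {a b c c₁ : V}
    (hpend : ∀ x, x ≠ a → x ≠ b → x ≠ c → (0 : ℝ) < w s(c, x) → x = c₁)
    (h : ∀ ω η : Set (Sym2 V), (∀ e ∈ ω, (0 : ℝ) < w e) → (∀ e ∈ η, (0 : ℝ) < w e) →
      ¬ (openGraph ω).Reachable a b → ¬ (openGraph ω).Reachable a c₁ →
      ¬ (openGraph ω).Reachable b c₁ → ¬ (openGraph (η \ barOf {a} (setCl ω {a}))).Reachable b c₁ →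
      ¬ ((∃ y k : V, (openGraph ω).Reachable a k ∧ (0 : ℝ) < w s(k, y) ∧ (openGraph ω).Reachable b y ∧
            (openGraph (η \ barOf {a} (setCl ω {a}))).Reachable c₁ y) ∧
         (∃ y k : V, (openGraph ω).Reachable a k ∧ (0 : ℝ) < w s(k, y) ∧ (openGraph ω).Reachable c₁ y ∧
            (openGraph (η \ barOf {a} (setCl ω {a}))).Reachable b y))) :
    ∀ ω η : Set (Sym2 V), (∀ e ∈ ω, (0 : ℝ) < w e) → (∀ e ∈ η, (0 : ℝ) < w e) →
      ¬ (openGraph ω).Reachable a b → ¬ (openGraph ω).Reachable a c →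
      ¬ (openGraph ω).Reachable b c → ¬ (openGraph (η \ barOf {a} (setCl ω {a}))).Reachable b c →
      ¬ ((∃ y k : V, (openGraph ω).Reachable a k ∧ (0 : ℝ) < w s(k, y) ∧ (openGraph ω).Reachable b y ∧
            (openGraph (η \ barOf {a} (setCl ω {a}))).Reachable c y) ∧
         (∃ y k : V, (openGraph ω).Reachable a k ∧ (0 : ℝ) < w s(k, y) ∧ (openGraph ω).Reachable c y ∧
            (openGraph (η \ barOf {a} (setCl ω {a}))).Reachable b y)) := by
  rintro ω η hω hη hab hac hbc hbc' ⟨⟨y, k, hk, hw, hby, hcy⟩, ⟨y', k', hk', hw', hcy', hby'⟩⟩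
  set θ := η \ barOf {a} (setCl ω {a}) with hθdef
  have hpendω : ∀ x, (openGraph ω).Adj c x → x = c₁ := by
    intro x hx
    have hx' := (openGraph_adj ω c x).1 hx
    refine hpend x ?_ ?_ (fun hxc => hx'.2 hxc.symm) (hω _ hx'.1)
    · rintro rfl; exact hac hx.reachable.symm
    · rintro rfl; exact hbc hx.reachable.symm
  have hpendθ : ∀ x, (openGraph θ).Adj c x → x = c₁ := by
    intro x hx
    have hx' := (openGraph_adj θ c x).1 hx
    refine hpend x ?_ ?_ (fun hxc => hx'.2 hxc.symm) (hη _ hx'.1.1)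
    · rintro rfl
      have hcut := hx'.1.2
      rw [barOf_setCl_singleton_eq_cutSet] at hcut
      exact hcut ⟨x, Sym2.mem_mk_right c x, SimpleGraph.Reachable.refl x⟩
    · rintro rfl; exact hbc' hx.reachable.symm
  have hyc : y ≠ c := by rintro rfl; exact hbc hby
  have hy'c : y' ≠ c := by rintro rfl; exact hbc' hby'
  obtain ⟨hcc₁ω, hc₁y'⟩ := reachable_pendant hpendω hcy' hy'c
  obtain ⟨hcc₁θ, hc₁y⟩ := reachable_pendant hpendθ hcy hyc
  exact h ω η hω hη hab (fun h' => hac (h'.trans hcc₁ω.symm)) (fun h' => hbc (h'.trans hcc₁ω.symm))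
    (fun h' => hbc' (h'.trans hcc₁θ.symm)) ⟨⟨y, k, hk, hw, hby, hc₁y⟩, ⟨y', k', hk', hw', hc₁y', hby'⟩⟩

/-- **Near-pendant root contracts**: if every positive pair at `a` other than `{a, b}`, `{a, c}` goes to `a₁`, then
`NDC(a₁; b, c) ⟹ NDC(a; b, c)`. [folklore; input for Gladkov2024, Thm. 4.3] -/
theorem noDoubleClash_of_nearPendant_root (w : Sym2 V → unitInterval) {a a₁ b c : V}
    (hpend : ∀ x, x ≠ a → x ≠ b → x ≠ c → (0 : ℝ) < w s(a, x) → x = a₁)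
    (h : ∀ ω η : Set (Sym2 V), (∀ e ∈ ω, (0 : ℝ) < w e) → (∀ e ∈ η, (0 : ℝ) < w e) →
      ¬ (openGraph ω).Reachable a₁ b → ¬ (openGraph ω).Reachable a₁ c →
      ¬ (openGraph ω).Reachable b c → ¬ (openGraph (η \ barOf {a₁} (setCl ω {a₁}))).Reachable b c →
      ¬ ((∃ y k : V, (openGraph ω).Reachable a₁ k ∧ (0 : ℝ) < w s(k, y) ∧ (openGraph ω).Reachable b y ∧
            (openGraph (η \ barOf {a₁} (setCl ω {a₁}))).Reachable c y) ∧
         (∃ y k : V, (openGraph ω).Reachable a₁ k ∧ (0 : ℝ) < w s(k, y) ∧ (openGraph ω).Reachable c y ∧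
            (openGraph (η \ barOf {a₁} (setCl ω {a₁}))).Reachable b y))) :
    ∀ ω η : Set (Sym2 V), (∀ e ∈ ω, (0 : ℝ) < w e) → (∀ e ∈ η, (0 : ℝ) < w e) →
      ¬ (openGraph ω).Reachable a b → ¬ (openGraph ω).Reachable a c →
      ¬ (openGraph ω).Reachable b c → ¬ (openGraph (η \ barOf {a} (setCl ω {a}))).Reachable b c →
      ¬ ((∃ y k : V, (openGraph ω).Reachable a k ∧ (0 : ℝ) < w s(k, y) ∧ (openGraph ω).Reachable b y ∧
            (openGraph (η \ barOf {a} (setCl ω {a}))).Reachable c y) ∧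
         (∃ y k : V, (openGraph ω).Reachable a k ∧ (0 : ℝ) < w s(k, y) ∧ (openGraph ω).Reachable c y ∧
            (openGraph (η \ barOf {a} (setCl ω {a}))).Reachable b y)) := by
  rintro ω η hω hη hab hac hbc hbc' ⟨⟨y, k, hk, hw, hby, hcy⟩, ⟨y', k', hk', hw', hcy', hby'⟩⟩
  have hpendω : ∀ x, (openGraph ω).Adj a x → x = a₁ := by
    intro x hx
    have hx' := (openGraph_adj ω a x).1 hx
    refine hpend x (fun hxa => hx'.2 hxa.symm) ?_ ?_ (hω _ hx'.1)
    · rintro rfl; exact hab hx.reachable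
    · rintro rfl; exact hac hx.reachable
  have hya : y ≠ a := by rintro rfl; exact hab hby.symm
  have hy'a : y' ≠ a := by rintro rfl; exact hac hcy'.symm
  have hyb : y ≠ b := by rintro rfl; exact hbc' hcy.symm
  have hyc : y ≠ c := by rintro rfl; exact hbc hby
  have hy'b : y' ≠ b := by rintro rfl; exact hbc hcy'.symm
  have hy'c : y' ≠ c := by rintro rfl; exact hbc' hby'
  have haa₁ : (openGraph ω).Reachable a a₁ := by
    by_cases hka : k = a
    · by_cases hk'a : k' = a
      · subst hka; subst hk'a
        have h1 : y = a₁ := hpend y hya hyb hyc hw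
        have h2 : y' = a₁ := hpend y' hy'a hy'b hy'c hw'
        exact absurd (hby.trans (h1.trans h2.symm ▸ hcy'.symm)) hbc
      · exact (reachable_pendant hpendω hk' hk'a).1
    · exact (reachable_pendant hpendω hk hka).1
  have hcut : barOf {a} (setCl ω {a}) = barOf {a₁} (setCl ω {a₁}) := by
    rw [barOf_setCl_singleton_eq_cutSet, barOf_setCl_singleton_eq_cutSet]
    ext e
    simp only [cutSet, Set.mem_setOf_eq]
    constructor
    · rintro ⟨u, hu, hr⟩; exact ⟨u, hu, haa₁.symm.trans hr⟩
    · rintro ⟨u, hu, hr⟩; exact ⟨u, hu, haa₁.trans hr⟩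
  rw [hcut] at hbc' hcy hby'
  exact h ω η hω hη (fun h' => hab (haa₁.trans h')) (fun h' => hac (haa₁.trans h')) hbc hbc'
    ⟨⟨y, k, haa₁.symm.trans hk, hw, hby, hcy⟩, ⟨y', k', haa₁.symm.trans hk', hw', hcy', hby'⟩⟩

end Consts

end Summit.CriticalPhenomena.PercolationContinuityZ3.Theorems
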